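import Mathlib
import Summits.KontsevichZagierPeriods.Zeta5Search.TS1RayCasLB
import Summits.KontsevichZagierPeriods.Zeta5Search.FlagRayDominance
import HarnessLib

/-!
# ζ(5) search — `N_p`, the refund and ⌊d/p⌋ on TOP_STAIR #1 (ray H1); DOMINANCE and (CV) for every prime `p > 8.5n`, every `j`, all `n` (part 2)

Cell `pub-zeta5` (HONEST FRAMING: systematic search; no irrationality claim unless certified), TRACK «DENOM-LAW» D1 prover seat
(denom-prover-d1 g13, `HOME/denom-law/prover-d1/ATTEMPT-13.md`).  On TOP_STAIR #1 = ray H1, `b(n) = n·(34; 14,…,8) = bLin (8n) (6n) n` (`d = 25n`; first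
period ⟺ `p > 8.5n`): the 21 pair blocks are `(6+i+k)·n`, `0 ≤ i < k ≤ 6`, so for `p > 8.5n`
`N_p = 2[p≤9n] + 2[p≤10n] + 3[p≤11n] + 3[p≤12n] + 3[p≤13n] + 2[p≤14n] + 2[p≤15n] + [p≤16n] + [p≤17n]` (`pairFloors_h1`; cells: 19, 17, 15, 12, 9, 6, 4, 2, 1, 0),
the refund is `1` up to `25n` and `0` beyond.  With `TS1RayCasLB` this gives **DOMINANCE `refund − N_p ≤ casLB(b(n),p)` at EVERY prime `p > 8.5n`**
(no exceptional band on this ray: `−18 ≤ −11`, `−16 ≤ −9`, `−14 ≤ −9`, `−11 ≤ −7/−9`, `−8 ≤ −7`, `−5`, `−3`, `−1`, `0`, `1`, `0`, `0` cell by cell) and hence, by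
THEOREM LB for any `j` (`cas_ge_casLB`), **(CV) `v_p(Cas_j(b(n))) ≥ refund − N_p` for every `n ≥ 1`, every `1 ≤ j ≤ 7` and every prime `p > 8.5n`**
(`ts1RayCV_gt85`).  §3: the two bonus cells read for any `j` — the double drop on `34n < 3p ≤ 36n` (`v ≥ −7 = casLB + 2`, the tree's `StairFLAG.cover_B_j`)
and the collinearity rung on `12n < p < 12.5n` (`v ≥ −6 = casLB + 1`; `cover_O_j` = `RayH1Levels.h1_O` with `7 ↦ j`: `N = 5` odd, two orbit keys
`[−1,−4]`, `[−2,−3]`, moment range `4p ≤ 50n + 1` ⟺ the cell) — used by `DenomLaw/TS1RayPath`.  The census's `RayH1LettersK001–K004` windows are the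
`j = 7`, `n ≥ 2…8` instances of four of these cells.  MODEL/structure-side integer bookkeeping; nothing about ζ(5); no γ; records in print UNMOVED.
-/

open Finset

namespace Summit.KontsevichZagierPeriods.Zeta5Search.StairTS1

open Summit.KontsevichZagierPeriods.Zeta5Search.ClusterValuation
open Summit.KontsevichZagierPeriods.Zeta5Search.CasoratianValuation (InPolytope shift casoratian pairFloors refund)
open Summit.KontsevichZagierPeriods.Zeta5Search.WedgeDictionary (dOf)
open Summit.KontsevichZagierPeriods.Zeta5Search.ClassTypeCover
open Summit.KontsevichZagierPeriods.Zeta5Search.CellKit (bLin)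
open Summit.KontsevichZagierPeriods.Zeta5Search.StairFLAG (cover_B_j)

/-! ## §2 The refund, `⌊d/p⌋` and `N_p` on the ray -/

section Arith
variable {n p : ℕ}

/-- `refund = 1` for `p ≤ 25n = d`. -/
theorem refund_h1_one (hp0 : 0 < p) (h : p ≤ 25 * n) : refund (bLin (8 * n) (6 * n) n) p = 1 := by
  unfold refund; rw [dOf_h1]; apply min_eq_left
  rw [Int.le_ediv_iff_mul_le (by exact_mod_cast hp0)]; nlinarith

/-- `refund = 0` for `p > 25n`. -/
theorem refund_h1_zero (h : 25 * n < p) : refund (bLin (8 * n) (6 * n) n) p = 0 := by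
  unfold refund
  rw [dOf_h1, Int.ediv_eq_zero_of_lt (by positivity) (by exact_mod_cast (show 25 * n < p by omega))]; norm_num

/-- `⌊d/p⌋ = 2` for `25n < 3p`, `2p ≤ 25n`. -/
theorem dOf_h1_div_two (h1 : 25 * n < 3 * p) (h2 : 2 * p ≤ 25 * n) : dOf (bLin (8 * n) (6 * n) n) / (p : ℤ) = 2 := by
  have hp0 : (0 : ℤ) < p := by exact_mod_cast (show 0 < p by omega)
  have h1' : (25 * n : ℤ) < 3 * p := by exact_mod_cast h1
  have h2' : (2 * p : ℤ) ≤ 25 * n := by exact_mod_cast h2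
  rw [dOf_h1]
  apply le_antisymm
  · have : (25 * (n : ℤ)) / (p : ℤ) < 3 := by rw [Int.ediv_lt_iff_lt_mul hp0]; linarith
    omega
  · rw [Int.le_ediv_iff_mul_le hp0]; linarith

/-- `⌊d/p⌋ = 1` for `25n < 2p`, `p ≤ 25n`. -/
theorem dOf_h1_div_one (h1 : 25 * n < 2 * p) (h2 : p ≤ 25 * n) : dOf (bLin (8 * n) (6 * n) n) / (p : ℤ) = 1 := by
  have hp0 : (0 : ℤ) < p := by exact_mod_cast (show 0 < p by omega)
  have h1' : (25 * n : ℤ) < 2 * p := by exact_mod_cast h1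
  have h2' : (p : ℤ) ≤ 25 * n := by exact_mod_cast h2
  rw [dOf_h1]
  apply le_antisymm
  · have : (25 * (n : ℤ)) / (p : ℤ) < 2 := by rw [Int.ediv_lt_iff_lt_mul hp0]; linarith
    omega
  · rw [Int.le_ediv_iff_mul_le hp0]; linarith

/-- `⌊d/p⌋ = 0` for `p > 25n`. -/
theorem dOf_h1_div_zero (h : 25 * n < p) : dOf (bLin (8 * n) (6 * n) n) / (p : ℤ) = 0 := by
  rw [dOf_h1]; exact Int.ediv_eq_zero_of_lt (by positivity) (by exact_mod_cast (show 25 * n < p by omega))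

/-- `⌊d/p⌋ ≤ 2` on the first period (`25n < 3p`). -/
theorem dOf_h1_div_le_two (h : 25 * n < 3 * p) : dOf (bLin (8 * n) (6 * n) n) / (p : ℤ) ≤ 2 := by
  have hp0 : (0 : ℤ) < p := by exact_mod_cast (show 0 < p by omega)
  have h1' : (25 * n : ℤ) < 3 * p := by exact_mod_cast h
  rw [dOf_h1]
  have : (25 * (n : ℤ)) / (p : ℤ) < 3 := by rw [Int.ediv_lt_iff_lt_mul hp0]; linarith
  omega

/-- **`N_p` on the first-period ray** (`p > 8.5n`; the 21 pair blocks are `c·n` with `c = 6 + i + k`, `0 ≤ i < k ≤ 6`, each `< 2p`):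
`N_p = 2[p≤9n] + 2[p≤10n] + 3[p≤11n] + 3[p≤12n] + 3[p≤13n] + 2[p≤14n] + 2[p≤15n] + [p≤16n] + [p≤17n]`. -/
theorem pairFloors_h1 (hp : 17 * n < 2 * p) :
    pairFloors (bLin (8 * n) (6 * n) n) p =
      2 * (if p ≤ 9 * n then 1 else 0) + 2 * (if p ≤ 10 * n then 1 else 0) + 3 * (if p ≤ 11 * n then 1 else 0) +
      3 * (if p ≤ 12 * n then 1 else 0) + 3 * (if p ≤ 13 * n then 1 else 0) + 2 * (if p ≤ 14 * n then 1 else 0) +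
      2 * (if p ≤ 15 * n then 1 else 0) + (if p ≤ 16 * n then 1 else 0) + (if p ≤ 17 * n then 1 else 0) := by
  have hp0 : (0 : ℤ) < p := by exact_mod_cast (show 0 < p by omega)
  have hq0 : ∀ (a b : ℤ) (c : ℕ), (34 : ℤ) - a - b = c → c * n < p →
      ((34 : ℤ) * n - a * n - b * n) / (p : ℤ) = 0 := by
    intro a b c h h2
    rw [show (34 : ℤ) * n - a * n - b * n = (c : ℤ) * n by rw [← h]; ring]
    exact Int.ediv_eq_zero_of_lt (by positivity) (by exact_mod_cast h2)
  have hq1 : ∀ (a b : ℤ) (c : ℕ), (34 : ℤ) - a - b = c → c * n < 2 * p →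
      ((34 : ℤ) * n - a * n - b * n) / (p : ℤ) = if p ≤ c * n then 1 else 0 := by
    intro a b c h h2
    rw [show (34 : ℤ) * n - a * n - b * n = (c : ℤ) * n by rw [← h]; ring]
    have h2' : ((c * n : ℕ) : ℤ) < 2 * p := by exact_mod_cast h2
    push_cast at h2'
    split_ifs with hc
    · have hc' : (p : ℤ) ≤ c * n := by exact_mod_cast hc
      rw [Int.ediv_eq_iff_of_pos hp0]; constructor <;> linarith
    · push Not at hc
      have hc' : (c : ℤ) * n < p := by exact_mod_cast hc
      exact Int.ediv_eq_zero_of_lt (by positivity) hc'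
  suffices hR : ∀ R : ℤ,
      2 * (if p ≤ 9 * n then 1 else 0) + 2 * (if p ≤ 10 * n then 1 else 0) + 3 * (if p ≤ 11 * n then 1 else 0) +
      3 * (if p ≤ 12 * n then 1 else 0) + 3 * (if p ≤ 13 * n then 1 else 0) + 2 * (if p ≤ 14 * n then 1 else 0) +
      2 * (if p ≤ 15 * n then 1 else 0) + (if p ≤ 16 * n then 1 else 0) + (if p ≤ 17 * n then 1 else 0) = R →
      pairFloors (bLin (8 * n) (6 * n) n) p = R from hR _ rfl
  intro R hR
  unfold pairFloors
  simp only [sum_range_succ, sum_range_zero, zero_add, Nat.reduceAdd, w0, w1, w2, w3, w4, w5, w6, w7, Nat.lt_irrefl, if_false,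
    show (0:ℕ) < 1 by norm_num, show (0:ℕ) < 2 by norm_num, show (0:ℕ) < 3 by norm_num, show (0:ℕ) < 4 by norm_num, show (0:ℕ) < 5 by norm_num,
    show (0:ℕ) < 6 by norm_num, show (1:ℕ) < 2 by norm_num, show (1:ℕ) < 3 by norm_num, show (1:ℕ) < 4 by norm_num, show (1:ℕ) < 5 by norm_num,
    show (1:ℕ) < 6 by norm_num, show (2:ℕ) < 3 by norm_num, show (2:ℕ) < 4 by norm_num, show (2:ℕ) < 5 by norm_num, show (2:ℕ) < 6 by norm_num,
    show (3:ℕ) < 4 by norm_num, show (3:ℕ) < 5 by norm_num, show (3:ℕ) < 6 by norm_num, show (4:ℕ) < 5 by norm_num, show (4:ℕ) < 6 by norm_num,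
    show (5:ℕ) < 6 by norm_num, if_true,
    show ¬ (1:ℕ) < 0 by norm_num, show ¬ (2:ℕ) < 0 by norm_num, show ¬ (3:ℕ) < 0 by norm_num, show ¬ (4:ℕ) < 0 by norm_num, show ¬ (5:ℕ) < 0 by norm_num,
    show ¬ (6:ℕ) < 0 by norm_num, show ¬ (2:ℕ) < 1 by norm_num, show ¬ (3:ℕ) < 1 by norm_num, show ¬ (4:ℕ) < 1 by norm_num, show ¬ (5:ℕ) < 1 by norm_num,
    show ¬ (6:ℕ) < 1 by norm_num, show ¬ (3:ℕ) < 2 by norm_num, show ¬ (4:ℕ) < 2 by norm_num, show ¬ (5:ℕ) < 2 by norm_num, show ¬ (6:ℕ) < 2 by norm_num,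
    show ¬ (4:ℕ) < 3 by norm_num, show ¬ (5:ℕ) < 3 by norm_num, show ¬ (6:ℕ) < 3 by norm_num, show ¬ (5:ℕ) < 4 by norm_num, show ¬ (6:ℕ) < 4 by norm_num,
    show ¬ (6:ℕ) < 5 by norm_num, add_zero]
  rw [hq0 14 13 7 (by norm_num) (by omega), hq0 14 12 8 (by norm_num) (by omega),
      hq1 14 11 9 (by norm_num) (by omega), hq1 14 10 10 (by norm_num) (by omega), hq1 14 9 11 (by norm_num) (by omega),
      hq1 14 8 12 (by norm_num) (by omega), hq1 13 12 9 (by norm_num) (by omega), hq1 13 11 10 (by norm_num) (by omega),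
      hq1 13 10 11 (by norm_num) (by omega), hq1 13 9 12 (by norm_num) (by omega), hq1 13 8 13 (by norm_num) (by omega),
      hq1 12 11 11 (by norm_num) (by omega), hq1 12 10 12 (by norm_num) (by omega), hq1 12 9 13 (by norm_num) (by omega),
      hq1 12 8 14 (by norm_num) (by omega), hq1 11 10 13 (by norm_num) (by omega), hq1 11 9 14 (by norm_num) (by omega),
      hq1 11 8 15 (by norm_num) (by omega), hq1 10 9 15 (by norm_num) (by omega), hq1 10 8 16 (by norm_num) (by omega),
      hq1 9 8 17 (by norm_num) (by omega), ← hR]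
  ring

/-- `N_p = 19` on `17n < 2p`, `p ≤ 9n`. -/
theorem N_c8 (hA : 17 * n < 2 * p) (hB : p ≤ 9 * n) : pairFloors (bLin (8 * n) (6 * n) n) p = 19 := by
  rw [pairFloors_h1 hA, if_pos (show p ≤ 9 * n by omega), if_pos (show p ≤ 10 * n by omega), if_pos (show p ≤ 11 * n by omega), if_pos (show p ≤ 12 * n by omega), if_pos (show p ≤ 13 * n by omega), if_pos (show p ≤ 14 * n by omega), if_pos (show p ≤ 15 * n by omega), if_pos (show p ≤ 16 * n by omega), if_pos (show p ≤ 17 * n by omega)]; norm_num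

/-- `N_p = 17` on `9n < p ≤ 10n`. -/
theorem N_c9 (hA : 9 * n < p) (hB : p ≤ 10 * n) : pairFloors (bLin (8 * n) (6 * n) n) p = 17 := by
  rw [pairFloors_h1 (by omega), if_neg (show ¬ p ≤ 9 * n by omega), if_pos (show p ≤ 10 * n by omega), if_pos (show p ≤ 11 * n by omega), if_pos (show p ≤ 12 * n by omega), if_pos (show p ≤ 13 * n by omega), if_pos (show p ≤ 14 * n by omega), if_pos (show p ≤ 15 * n by omega), if_pos (show p ≤ 16 * n by omega), if_pos (show p ≤ 17 * n by omega)]; norm_num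

/-- `N_p = 15` on `10n < p ≤ 11n`. -/
theorem N_c10 (hA : 10 * n < p) (hB : p ≤ 11 * n) : pairFloors (bLin (8 * n) (6 * n) n) p = 15 := by
  rw [pairFloors_h1 (by omega), if_neg (show ¬ p ≤ 9 * n by omega), if_neg (show ¬ p ≤ 10 * n by omega), if_pos (show p ≤ 11 * n by omega), if_pos (show p ≤ 12 * n by omega), if_pos (show p ≤ 13 * n by omega), if_pos (show p ≤ 14 * n by omega), if_pos (show p ≤ 15 * n by omega), if_pos (show p ≤ 16 * n by omega), if_pos (show p ≤ 17 * n by omega)]; norm_num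

/-- `N_p = 12` on `11n < p ≤ 12n`. -/
theorem N_c11 (hA : 11 * n < p) (hB : p ≤ 12 * n) : pairFloors (bLin (8 * n) (6 * n) n) p = 12 := by
  rw [pairFloors_h1 (by omega), if_neg (show ¬ p ≤ 9 * n by omega), if_neg (show ¬ p ≤ 10 * n by omega), if_neg (show ¬ p ≤ 11 * n by omega), if_pos (show p ≤ 12 * n by omega), if_pos (show p ≤ 13 * n by omega), if_pos (show p ≤ 14 * n by omega), if_pos (show p ≤ 15 * n by omega), if_pos (show p ≤ 16 * n by omega), if_pos (show p ≤ 17 * n by omega)]; norm_num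

/-- `N_p = 9` on `12n < p ≤ 13n`. -/
theorem N_c12 (hA : 12 * n < p) (hB : p ≤ 13 * n) : pairFloors (bLin (8 * n) (6 * n) n) p = 9 := by
  rw [pairFloors_h1 (by omega), if_neg (show ¬ p ≤ 9 * n by omega), if_neg (show ¬ p ≤ 10 * n by omega), if_neg (show ¬ p ≤ 11 * n by omega), if_neg (show ¬ p ≤ 12 * n by omega), if_pos (show p ≤ 13 * n by omega), if_pos (show p ≤ 14 * n by omega), if_pos (show p ≤ 15 * n by omega), if_pos (show p ≤ 16 * n by omega), if_pos (show p ≤ 17 * n by omega)]; norm_num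

/-- `N_p = 6` on `13n < p ≤ 14n`. -/
theorem N_c13 (hA : 13 * n < p) (hB : p ≤ 14 * n) : pairFloors (bLin (8 * n) (6 * n) n) p = 6 := by
  rw [pairFloors_h1 (by omega), if_neg (show ¬ p ≤ 9 * n by omega), if_neg (show ¬ p ≤ 10 * n by omega), if_neg (show ¬ p ≤ 11 * n by omega), if_neg (show ¬ p ≤ 12 * n by omega), if_neg (show ¬ p ≤ 13 * n by omega), if_pos (show p ≤ 14 * n by omega), if_pos (show p ≤ 15 * n by omega), if_pos (show p ≤ 16 * n by omega), if_pos (show p ≤ 17 * n by omega)]; norm_num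

/-- `N_p = 4` on `14n < p ≤ 15n`. -/
theorem N_c14 (hA : 14 * n < p) (hB : p ≤ 15 * n) : pairFloors (bLin (8 * n) (6 * n) n) p = 4 := by
  rw [pairFloors_h1 (by omega), if_neg (show ¬ p ≤ 9 * n by omega), if_neg (show ¬ p ≤ 10 * n by omega), if_neg (show ¬ p ≤ 11 * n by omega), if_neg (show ¬ p ≤ 12 * n by omega), if_neg (show ¬ p ≤ 13 * n by omega), if_neg (show ¬ p ≤ 14 * n by omega), if_pos (show p ≤ 15 * n by omega), if_pos (show p ≤ 16 * n by omega), if_pos (show p ≤ 17 * n by omega)]; norm_num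

/-- `N_p = 2` on `15n < p ≤ 16n`. -/
theorem N_c15 (hA : 15 * n < p) (hB : p ≤ 16 * n) : pairFloors (bLin (8 * n) (6 * n) n) p = 2 := by
  rw [pairFloors_h1 (by omega), if_neg (show ¬ p ≤ 9 * n by omega), if_neg (show ¬ p ≤ 10 * n by omega), if_neg (show ¬ p ≤ 11 * n by omega), if_neg (show ¬ p ≤ 12 * n by omega), if_neg (show ¬ p ≤ 13 * n by omega), if_neg (show ¬ p ≤ 14 * n by omega), if_neg (show ¬ p ≤ 15 * n by omega), if_pos (show p ≤ 16 * n by omega), if_pos (show p ≤ 17 * n by omega)]; norm_num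

/-- `N_p = 1` on `16n < p ≤ 17n`. -/
theorem N_c16 (hA : 16 * n < p) (hB : p ≤ 17 * n) : pairFloors (bLin (8 * n) (6 * n) n) p = 1 := by
  rw [pairFloors_h1 (by omega), if_neg (show ¬ p ≤ 9 * n by omega), if_neg (show ¬ p ≤ 10 * n by omega), if_neg (show ¬ p ≤ 11 * n by omega), if_neg (show ¬ p ≤ 12 * n by omega), if_neg (show ¬ p ≤ 13 * n by omega), if_neg (show ¬ p ≤ 14 * n by omega), if_neg (show ¬ p ≤ 15 * n by omega), if_neg (show ¬ p ≤ 16 * n by omega), if_pos (show p ≤ 17 * n by omega)]; norm_num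

/-- `N_p = 0` for `p > 17n`. -/
theorem N_gt17 (hA : 17 * n < p) : pairFloors (bLin (8 * n) (6 * n) n) p = 0 := by
  rw [pairFloors_h1 (by omega), if_neg (show ¬ p ≤ 9 * n by omega), if_neg (show ¬ p ≤ 10 * n by omega), if_neg (show ¬ p ≤ 11 * n by omega), if_neg (show ¬ p ≤ 12 * n by omega), if_neg (show ¬ p ≤ 13 * n by omega), if_neg (show ¬ p ≤ 14 * n by omega), if_neg (show ¬ p ≤ 15 * n by omega), if_neg (show ¬ p ≤ 16 * n by omega), if_neg (show ¬ p ≤ 17 * n by omega)]; norm_num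
end Arith

/-! ## §3 Dominance at every prime `p > 8.5n`, the two bonus cells for any `j`, and (CV) for `p > 8.5n` -/

/-- An odd prime: `p % 2 = 1` once `17n < 2p` with `n ≥ 1` (so `p ≥ 9`). -/
theorem odd_of_prime_gt85 {n p : ℕ} (hprime : p.Prime) (h : 17 * n < 2 * p) (hn : 1 ≤ n) : p % 2 = 1 :=
  Nat.odd_iff.1 (hprime.odd_of_ne_two (by omega))

/-- **DOMINANCE on the whole first-period ray**: `refund − N_p ≤ casLB(b(n),p)` for every `n ≥ 1` and EVERY prime `p` with `17n < 2p`. -/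
theorem h1_dominance {n p : ℕ} (hn : 1 ≤ n) (hprime : p.Prime) (h85 : 17 * n < 2 * p) :
    refund (bLin (8 * n) (6 * n) n) p - pairFloors (bLin (8 * n) (6 * n) n) p ≤ casLB (bLin (8 * n) (6 * n) n) p := by
  haveI : Fact p.Prime := ⟨hprime⟩
  have hp0 : 0 < p := hprime.pos
  have hp2 := odd_of_prime_gt85 hprime h85 hn
  by_cases h34 : 34 * n < p
  · rw [refund_h1_zero (by omega), N_gt17 (by omega)]
    linarith [casLB_gt34 (n := n) h34]
  by_cases h25 : 25 * n < p
  · rw [refund_h1_zero h25, N_gt17 (by omega)]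
    linarith [casLB_c25 (n := n) (p := p) (by omega) (by omega) hp2]
  push Not at h25
  rw [refund_h1_one hp0 h25]
  by_cases h : p ≤ 9 * n
  · rw [N_c8 h85 h]; linarith [casLB_c8 (n := n) (p := p) h85 (by omega) hp2]
  by_cases h' : p ≤ 10 * n
  · rw [N_c9 (by omega) h']; linarith [casLB_c9 (n := n) (p := p) (by omega) (by omega) hp2]
  by_cases h : p ≤ 11 * n
  · rw [N_c10 (by omega) h]; linarith [casLB_c10 (n := n) (p := p) (by omega) (by omega) hp2]
  by_cases h' : 3 * p ≤ 34 * n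
  · rw [N_c11 (by omega) (by omega)]; linarith [casLB_c11a (n := n) (p := p) (by omega) h' hp2]
  by_cases h : p ≤ 12 * n
  · rw [N_c11 (by omega) h]; linarith [casLB_c11b (n := n) (p := p) (by omega) (by omega) hp2]
  by_cases h' : 2 * p < 25 * n
  · rw [N_c12 (by omega) (by omega)]; linarith [casLB_c12a (n := n) (p := p) (by omega) h' hp2]
  by_cases h : p ≤ 13 * n
  · -- `2p = 25n` is impossible for a prime `p ≥ 5`
    have h25' : 25 * n < 2 * p := by
      rcases Nat.lt_or_ge (25 * n) (2 * p) with hlt | hge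
      · exact hlt
      · exfalso
        have heq : 2 * p = 25 * n := by omega
        have h5 : 5 ∣ p := by
          have : 5 ∣ 2 * p := ⟨5 * n, by omega⟩
          exact (Nat.Coprime.dvd_of_dvd_mul_left (by norm_num) this)
        have := (Nat.prime_dvd_prime_iff_eq (by norm_num) hprime).1 h5
        omega
    rw [N_c12 (by omega) h]; linarith [casLB_c12b (n := n) (p := p) h25' (by omega) hp2]
  by_cases h' : p ≤ 14 * n
  · rw [N_c13 (by omega) h']; linarith [casLB_c13 (n := n) (p := p) (by omega) (by omega) hp2]
  by_cases h : p ≤ 15 * n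
  · rw [N_c14 (by omega) h]; linarith [casLB_c14 (n := n) (p := p) (by omega) (by omega) hp2]
  by_cases h' : p ≤ 16 * n
  · rw [N_c15 (by omega) h']; linarith [casLB_c15 (n := n) (p := p) (by omega) (by omega) hp2]
  by_cases h : p ≤ 17 * n
  · rw [N_c16 (by omega) h]; linarith [casLB_c16 (n := n) (p := p) (by omega) (by omega) hp2]
  · rw [N_gt17 (by omega)]; linarith [casLB_c17 (n := n) (p := p) (by omega) (by omega) hp2]

/-- **The collinearity rung (rung O) for any direction `j`** (`RayH1Levels.h1_O` / `ClassTypeGuardsO.rungO_of_cover` with `7 ↦ j`): `c ≤ v_p(Cas_j(b))`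
from a cover, `checkLB` at `(−N, B)` with `c ≤ −N + B + 1`, `checkO` at `N` (`N ≥ 3` odd, two keys) inside the moment range `(N−1)p + 2 ≤ 2d + 3`, and the
fallback `checkLBx` at `(−N; A', B')` with `c ≤ A' + B'`. -/
theorem cover_O_j {b : ℕ → ℤ} {p j : ℕ} (hb : InPolytope b) (hj1 : 1 ≤ j) (hj7 : j ≤ 7) (hb' : InPolytope (shift b j)) (hpr : p.Prime)
    (hp5 : 5 ≤ p) (hpb : (p : ℤ) ≤ b 0) (hpd : (p : ℤ) ≤ dOf b) (hwin : (b 0 + 2 : ℤ) < (p : ℤ) ^ 2)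
    {TY : List (List ℤ × Bool)} (hcov : Cover b p TY) {N : ℕ} (hN : 3 ≤ N) (hodd : N % 2 = 1)
    (hrange : ((N : ℤ) - 1) * p + 2 ≤ 2 * dOf b + 3) {K₁ K₂ : Bool × List ℤ} {B A' B' c : ℤ}
    (hLB : checkLB (decide (¬ (2 : ℤ) ∣ b 0)) TY (-(N : ℤ)) B = true) (hB1 : B ≤ 1)
    (hO : checkO (decide (¬ (2 : ℤ) ∣ b 0)) TY N K₁ K₂ = true)
    (hLBx : checkLBx (decide (¬ (2 : ℤ) ∣ b 0)) TY (-(N : ℤ)) A' B' = true) (hB1' : B' ≤ 1)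
    (hc : c ≤ -(N : ℤ) + B + 1) (hc' : c ≤ A' + B') (hc0 : c ≤ 0)
    (hne : casoratian b j ≠ 0) : c ≤ padicValRat p (casoratian b j) := by
  haveI : Fact p.Prime := ⟨hpr⟩
  have hv := casoratianClassBound_holds b j p hb hj1 hj7 hb' hpr hp5 hwin hne
  by_cases hreal : ∃ x, x < p ∧ 2 ≤ classPoleCount b p x ∧ classExp b p x = -(N : ℤ)
  · have hO' := rungO_of_cover hb hj1 hj7 hb' hpr hp5 hpb hpd hwin hcov hN hodd hrange hO hreal hne
    rcases casLB_ge_of_cover hcov hLB hB1 hpd with h0 | h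
    · rw [h0] at hv; exact le_trans (by exact_mod_cast hc0) hv
    · linarith
  · rcases casLB_ge_of_cover_x hcov hLBx hB1' hpd hreal with h0 | h
    · rw [h0] at hv; exact le_trans (by exact_mod_cast hc0) hv
    · linarith

/-- **The double-drop cell `34n < 3p ≤ 36n`, any `j`**: `v_p(Cas_j(b(n))) ≥ −7` (`= casLB + 2` off `3p = 34n + 1`), from `cover_c11b` / `checkB_c11b`. -/
theorem cas_ge_c11b {n j p : ℕ} (hn : 1 ≤ n) (hj1 : 1 ≤ j) (hj7 : j ≤ 7) (hprime : p.Prime) (hA : 34 * n < 3 * p) (hB : p ≤ 12 * n)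
    (hcas : casoratian (bLin (8 * n) (6 * n) n) j ≠ 0) :
    (-7 : ℤ) ≤ padicValRat p (casoratian (bLin (8 * n) (6 * n) n) j) := by
  haveI : Fact p.Prime := ⟨hprime⟩
  have hp2 : p % 2 = 1 := odd_of_prime_gt85 hprime (by omega) hn
  obtain ⟨hp5, hwin⟩ := window85 hn (show 17 * n < 2 * p by omega)
  obtain ⟨h1, h2, h3⟩ := checkB_c11b
  exact cover_B_j (inPolytope_h1 n) hj1 hj7 (inPolytope_shift_h1_j hn j hj1 hj7) hprime hp5 (le_b0_h1 (by omega)) (le_dOf_h1 (by omega)) hwin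
    (cover_c11b hA (by omega) hp2) (N := 6) (by norm_num) (by decide)
    (by rw [oddFlag_bH1lin n]; exact h1) (by norm_num) (by rw [oddFlag_bH1lin n]; exact h2) (by rw [oddFlag_bH1lin n]; exact h3)
    (by norm_num) (by norm_num) (by norm_num) (by norm_num) hcas

/-- **The collinearity cell `12n < p < 12.5n`, any `j`**: `v_p(Cas_j(b(n))) ≥ −6 = casLB + 1`, from `cover_c12a` / `checkO_c12a` (`N = 5`, keys `[−1,−4]`,
`[−2,−3]`; the moment range `4p + 2 ≤ 50n + 3` is exactly the cell). -/
theorem cas_ge_c12a {n j p : ℕ} (hn : 1 ≤ n) (hj1 : 1 ≤ j) (hj7 : j ≤ 7) (hprime : p.Prime) (hA : 12 * n < p) (hB : 2 * p < 25 * n)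
    (hcas : casoratian (bLin (8 * n) (6 * n) n) j ≠ 0) :
    (-6 : ℤ) ≤ padicValRat p (casoratian (bLin (8 * n) (6 * n) n) j) := by
  haveI : Fact p.Prime := ⟨hprime⟩
  have hp2 : p % 2 = 1 := odd_of_prime_gt85 hprime (by omega) hn
  obtain ⟨hp5, hwin⟩ := window85 hn (show 17 * n < 2 * p by omega)
  obtain ⟨h1, h2, h3⟩ := checkO_c12a
  have hrange : ((5 : ℕ) - 1 : ℤ) * p + 2 ≤ 2 * dOf (bLin (8 * n) (6 * n) n) + 3 := by
    rw [dOf_h1]; push_cast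
    have : (2 * p : ℤ) < 25 * n := by exact_mod_cast hB
    linarith
  exact cover_O_j (inPolytope_h1 n) hj1 hj7 (inPolytope_shift_h1_j hn j hj1 hj7) hprime hp5 (le_b0_h1 (by omega)) (le_dOf_h1 (by omega)) hwin
    (cover_c12a (by omega) hB hp2) (N := 5) (by norm_num) (by norm_num) hrange
    (by rw [oddFlag_bH1lin n]; exact h1) (by norm_num) (by rw [oddFlag_bH1lin n]; exact h2) (by rw [oddFlag_bH1lin n]; exact h3)
    (by norm_num) (by norm_num) (by norm_num) (by norm_num) hcas

/-- **(CV) ON THE FIRST-PERIOD RAY H1, every direction `j`, all `n`**: for `n ≥ 1`, `1 ≤ j ≤ 7`, every prime `p` with `17n < 2p` and `Cas_j(b(n)) ≠ 0`,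
`refund − N_p ≤ v_p(Cas_j(b(n)))` — dominance + THEOREM LB (no exceptional band on this ray). -/
theorem ts1RayCV_gt85 (n j p : ℕ) (hn : 1 ≤ n) (hj1 : 1 ≤ j) (hj7 : j ≤ 7) (hprime : p.Prime) (h85 : 17 * n < 2 * p)
    (hcas : casoratian (bLin (8 * n) (6 * n) n) j ≠ 0) :
    refund (bLin (8 * n) (6 * n) n) p - pairFloors (bLin (8 * n) (6 * n) n) p
      ≤ padicValRat p (casoratian (bLin (8 * n) (6 * n) n) j) :=
  (h1_dominance hn hprime h85).trans (cas_ge_casLB hn hj1 hj7 hprime h85 hcas)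

end Summit.KontsevichZagierPeriods.Zeta5Search.StairTS1
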